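import Summits.AnomalousDissipation.AnomalousDissipation.Theorems.SolenoidalFractalHomogenisationLagrangianCarrierStreamPotential
import Summits.AnomalousDissipation.AnomalousDissipation.Theorems.SolenoidalFractalHomogenisationPermissibleFractalCarrierWords
import HarnessLib

/-!
# The stream potential of a rescaled lattice WORD carrier (all slots, envelopes, amplitude) — K1L `stub_tailL`, brick (a) completed

Helper file for crux K1L `LagrangianRenormalisationStep` (stmt-AnomalousDissipation-24912), registered stub `stub_tailL` (plan: evidence #30,
`STUB-PLAN-tailL-K1L.md`).  `…LagrangianCarrierStreamPotential` (p616309) gives the weak antisymmetric potential of ONE rescaled layer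
`(1/n) • P.layer (n • x)`.  An Eulerian level of a fractal carrier is `level m t = a_m • (word m).cell (N m) (a_m t)`, and
`a • W.cell n s x = Σ_j a · env_j(s) · (1/n) • layer_j (n • x)` with the trapezoid envelopes `|env_j| ≤ 1`; by linearity the word carrier has the
envelope-weighted sum of the slot potentials as weak potential (`integral_cell_mul_eq_neg_integral_potential`, the `Hψ` shape of
`PassiveVectorTensorStreamStability` at one time), bounded by `|a| k / (2π² n²)` (`abs_cellPotential_le`).  No definitions, no named facts, no sorry.
Prover seat `ad-solenoidal-k2r-lowerlaw-p1` g5, 2026-08-28.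
-/

set_option linter.dupNamespace false

noncomputable section

namespace Summit.AnomalousDissipation.AnomalousDissipation.Theorems.SolenoidalFractalHomogenisation.LagrangianCarrier

open Set MeasureTheory Function Complex
open scoped InnerProductSpace Real
open Literature.Analysis Literature.Analysis.FunctionSpaces Literature.Analysis.FunctionSpaces.Torus
open Literature.Analysis.FluidPDE Literature.Analysis.FluidPDE.LatticeShear
open Summit.AnomalousDissipation.AnomalousDissipation.Theorems.SolenoidalFractalHomogenisation.PermissibleCarrier
  (carrier_nsmul_apply abs_trapezoid_le_one isSmooth_layer_nsmul)

variable {k : ℕ} (W : LatticeWord k)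

/-- The rescaled word carrier in coordinates: `(a • W.cell n s x)_c = Σ_j a · env_j · ((1/n) • layer_j (n • x))_c`. [folklore] -/
theorem cell_smul_apply_eq_sum (n : ℕ) (a s : ℝ) (x : UnitAddTorus (Fin 3)) (c : Fin 3) :
    (a • W.cell n s x) c = ∑ j, a * LatticeWord.trapezoid (W.start j) (W.phase j).τ W.ramp (Int.fract (s / W.period) * W.period) *
      (((1 / (n : ℝ)) • (W.phase j).layer (n • x)) c) := by
  simp only [LatticeWord.cell, carrier_nsmul_apply, PiLp.smul_apply, smul_eq_mul, WithLp.ofLp_sum, Finset.sum_apply,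
    Finset.mul_sum]
  refine Finset.sum_congr rfl fun j _ => ?_
  ring

/-- **The stream potential of a rescaled word carrier** `x ↦ a • W.cell n s x`: the envelope-weighted sum of the slot potentials, in weak form
against smooth scalar tests.  Applies verbatim to the Eulerian levels `level m t = a_m • (word m).cell (N m) (a_m t)`.
[cite: ArmstrongVicol2025, §3 (alternating-shear fractal carrier: each level is a stream-function field)] -/
theorem integral_cell_mul_eq_neg_integral_potential (n : ℕ) (hn : 0 < n) (a s : ℝ) {φ : UnitAddTorus (Fin 3) → ℝ}
    (hφ : IsSmooth φ) (c : Fin 3) :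
    ∫ x, ((a • W.cell n s x) c) * φ x =
      -∫ x, ∑ i, (∑ j, a * LatticeWord.trapezoid (W.start j) (W.phase j).τ W.ramp (Int.fract (s / W.period) * W.period) *
        (-((UnitAddTorus.mFourier (fun l => (W.phase j).m l * n) x * Complex.exp ((W.phase j).φ * I)).re) *
          (((W.phase j).m i : ℝ) * (W.phase j).e c - (W.phase j).e i * ((W.phase j).m c : ℝ)) /
            (4 * Real.pi ^ 2 * (n : ℝ) ^ 2 * ‖latticeVec (W.phase j).m‖ ^ 3))) * Torus.partialDeriv i φ x := by
  -- abbreviations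
  set env : Fin k → ℝ := fun j => LatticeWord.trapezoid (W.start j) (W.phase j).τ W.ramp (Int.fract (s / W.period) * W.period)
    with henv
  set Ψ : Fin k → UnitAddTorus (Fin 3) → Fin 3 → ℝ := fun j x i =>
    -((UnitAddTorus.mFourier (fun l => (W.phase j).m l * n) x * Complex.exp ((W.phase j).φ * I)).re) *
      (((W.phase j).m i : ℝ) * (W.phase j).e c - (W.phase j).e i * ((W.phase j).m c : ℝ)) /
        (4 * Real.pi ^ 2 * (n : ℝ) ^ 2 * ‖latticeVec (W.phase j).m‖ ^ 3) with hΨ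
  set L : Fin k → UnitAddTorus (Fin 3) → ℝ := fun j x => (((1 / (n : ℝ)) • (W.phase j).layer (n • x)) c) with hL
  -- continuity facts
  have hLc : ∀ j, Continuous (L j) := fun j =>
    (EuclideanSpace.proj c).continuous.comp (((isSmooth_layer_nsmul (W.phase j) n).continuous).const_smul (1 / (n : ℝ)))
  have hΨc : ∀ j i, Continuous fun x => Ψ j x i := fun j i => (isSmooth_layerPotential (W.phase j) n i c).continuous
  have hφc : Continuous φ := hφ.continuous
  have hdφc : ∀ i, Continuous (Torus.partialDeriv i φ) := fun i => (hφ.partialDeriv i).continuous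
  have hI1 : ∀ j, Integrable (fun x => a * env j * L j x * φ x) volume := fun j =>
    (((continuous_const.mul (hLc j)).mul hφc)).integrable_unitAddTorus
  have hI2 : ∀ j, Integrable (fun x => a * env j * ∑ i, Ψ j x i * Torus.partialDeriv i φ x) volume := fun j =>
    (continuous_const.mul (continuous_finsetSum _ fun i _ => (hΨc j i).mul (hdφc i))).integrable_unitAddTorus
  -- left side: sum over slots
  have hleft : ∫ x, ((a • W.cell n s x) c) * φ x = ∑ j, a * env j * ∫ x, L j x * φ x := by
    have e : ∀ x, ((a • W.cell n s x) c) * φ x = ∑ j, a * env j * L j x * φ x := by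
      intro x
      rw [cell_smul_apply_eq_sum, Finset.sum_mul]
    simp_rw [e]
    rw [integral_finsetSum _ fun j _ => hI1 j]
    refine Finset.sum_congr rfl fun j _ => ?_
    rw [← integral_const_mul]
    refine integral_congr_ae (ae_of_all _ fun x => ?_)
    ring
  -- each slot: the single-layer potential
  have hslot : ∀ j, ∫ x, L j x * φ x = -∫ x, ∑ i, Ψ j x i * Torus.partialDeriv i φ x :=
    fun j => integral_layer_mul_eq_neg_integral_potential (W.phase j) n hn hφ c
  -- right side: swap the sums and pull out the constants
  have hright : ∫ x, ∑ i, (∑ j, a * env j * Ψ j x i) * Torus.partialDeriv i φ x =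
      ∑ j, a * env j * ∫ x, ∑ i, Ψ j x i * Torus.partialDeriv i φ x := by
    have e : ∀ x, ∑ i, (∑ j, a * env j * Ψ j x i) * Torus.partialDeriv i φ x =
        ∑ j, a * env j * ∑ i, Ψ j x i * Torus.partialDeriv i φ x := by
      intro x
      simp only [Finset.sum_mul, Finset.mul_sum]
      rw [Finset.sum_comm]
      refine Finset.sum_congr rfl fun j _ => Finset.sum_congr rfl fun i _ => ?_
      ring
    simp_rw [e]
    rw [integral_finsetSum _ fun j _ => hI2 j]
    refine Finset.sum_congr rfl fun j _ => ?_
    rw [← integral_const_mul]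
  rw [hleft, hright, ← Finset.sum_neg_distrib]
  refine Finset.sum_congr rfl fun j _ => ?_
  rw [hslot j]
  ring

/-- **Bound on the word potential**: `|Σ_j a env_j Ψ_j| ≤ |a| k / (2π² n²)` (`|env| ≤ 1`, `|m_j| ≥ 1`). [folklore] -/
theorem abs_cellPotential_le (n : ℕ) (hn : 0 < n) (a s : ℝ) (x : UnitAddTorus (Fin 3)) (i c : Fin 3) :
    |∑ j, a * LatticeWord.trapezoid (W.start j) (W.phase j).τ W.ramp (Int.fract (s / W.period) * W.period) *
        (-((UnitAddTorus.mFourier (fun l => (W.phase j).m l * n) x * Complex.exp ((W.phase j).φ * I)).re) *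
          (((W.phase j).m i : ℝ) * (W.phase j).e c - (W.phase j).e i * ((W.phase j).m c : ℝ)) /
            (4 * Real.pi ^ 2 * (n : ℝ) ^ 2 * ‖latticeVec (W.phase j).m‖ ^ 3))| ≤
      |a| * k / (2 * Real.pi ^ 2 * (n : ℝ) ^ 2) := by
  have hn' : (0 : ℝ) < n := by exact_mod_cast hn
  have hterm : ∀ j, |a * LatticeWord.trapezoid (W.start j) (W.phase j).τ W.ramp (Int.fract (s / W.period) * W.period) *
        (-((UnitAddTorus.mFourier (fun l => (W.phase j).m l * n) x * Complex.exp ((W.phase j).φ * I)).re) *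
          (((W.phase j).m i : ℝ) * (W.phase j).e c - (W.phase j).e i * ((W.phase j).m c : ℝ)) /
            (4 * Real.pi ^ 2 * (n : ℝ) ^ 2 * ‖latticeVec (W.phase j).m‖ ^ 3))| ≤ |a| * (1 / (2 * Real.pi ^ 2 * (n : ℝ) ^ 2)) := by
    intro j
    rw [abs_mul, abs_mul]
    have h1 := abs_trapezoid_le_one (W.start j) (W.phase j).τ W.ramp (Int.fract (s / W.period) * W.period)
    have h2 := abs_layerPotential_le (W.phase j) n hn x i c
    have hm : 1 ≤ ‖latticeVec (W.phase j).m‖ := one_le_norm_latticeVec (W.phase j).m_ne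
    have hden : 2 * Real.pi ^ 2 * (n : ℝ) ^ 2 ≤ 2 * Real.pi ^ 2 * (n : ℝ) ^ 2 * ‖latticeVec (W.phase j).m‖ ^ 2 := by
      have h0 : 0 < 2 * Real.pi ^ 2 * (n : ℝ) ^ 2 := by positivity
      have hm2 : (1 : ℝ) ≤ ‖latticeVec (W.phase j).m‖ ^ 2 := by nlinarith
      nlinarith
    have h3 : 1 / (2 * Real.pi ^ 2 * (n : ℝ) ^ 2 * ‖latticeVec (W.phase j).m‖ ^ 2) ≤ 1 / (2 * Real.pi ^ 2 * (n : ℝ) ^ 2) :=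
      one_div_le_one_div_of_le (by positivity) hden
    calc |a| * |LatticeWord.trapezoid (W.start j) (W.phase j).τ W.ramp (Int.fract (s / W.period) * W.period)| *
          |-((UnitAddTorus.mFourier (fun l => (W.phase j).m l * n) x * Complex.exp ((W.phase j).φ * I)).re) *
            (((W.phase j).m i : ℝ) * (W.phase j).e c - (W.phase j).e i * ((W.phase j).m c : ℝ)) /
              (4 * Real.pi ^ 2 * (n : ℝ) ^ 2 * ‖latticeVec (W.phase j).m‖ ^ 3)|
        ≤ |a| * 1 * (1 / (2 * Real.pi ^ 2 * (n : ℝ) ^ 2)) :=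
          mul_le_mul (mul_le_mul_of_nonneg_left h1 (abs_nonneg a)) (h2.trans h3) (abs_nonneg _) (by positivity)
      _ = |a| * (1 / (2 * Real.pi ^ 2 * (n : ℝ) ^ 2)) := by ring
  calc _ ≤ ∑ j, |a * LatticeWord.trapezoid (W.start j) (W.phase j).τ W.ramp (Int.fract (s / W.period) * W.period) *
        (-((UnitAddTorus.mFourier (fun l => (W.phase j).m l * n) x * Complex.exp ((W.phase j).φ * I)).re) *
          (((W.phase j).m i : ℝ) * (W.phase j).e c - (W.phase j).e i * ((W.phase j).m c : ℝ)) /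
            (4 * Real.pi ^ 2 * (n : ℝ) ^ 2 * ‖latticeVec (W.phase j).m‖ ^ 3))| := Finset.abs_sum_le_sum_abs _ _
    _ ≤ ∑ _j : Fin k, |a| * (1 / (2 * Real.pi ^ 2 * (n : ℝ) ^ 2)) := Finset.sum_le_sum fun j _ => hterm j
    _ = |a| * k / (2 * Real.pi ^ 2 * (n : ℝ) ^ 2) := by
        simp only [Finset.sum_const, Finset.card_univ, Fintype.card_fin, nsmul_eq_mul]
        ring

end Summit.AnomalousDissipation.AnomalousDissipation.Theorems.SolenoidalFractalHomogenisation.LagrangianCarrier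

end
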